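import Summits.SmoothPoincare4.SmoothPoincare4.Theorems.SoloInformedFiveDimensionalRoute
import Literature.Topology.FourManifolds.GluckTwist
import Literature.Topology.FourManifolds.GluckTwistHomotopySphere
import HarnessLib
import HarnessLib.Audit.Tags

/-!
# Gabai's Conjecture 13.3 (Gluck balls), double form — the first rung below Conjecture 13.1

Host summit `SmoothPoincare4` (soloist seat `solo-SmoothPoincare4-informed`).  D. Gabai,
*3-Spheres in the 4-Sphere and Pseudo-Isotopies of `S¹ × S³`*, arXiv:2212.02004v2 (2024), §13
p. 62: *"The following is a special case of the Gluck conjecture, that a Gluck twisted `S⁴` is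
diffeomorphic to `S⁴`.  Conjecture 13.3. If `Δ⁴` is a Gluck ball, then `Δ⁴ × I = B⁵`."*  Here a
*Gluck ball* is a Gluck-twisted 4-sphere `Σ_K` (along a 2-knot `K ⊂ S⁴`) with an open 4-ball
removed — a Poincaré ball, since `Σ_K` is a homotopy 4-sphere (Gluck 1962, §17); and by Remarks
13.2 (i) (Smale) `Δ × I = B⁵` is equivalent to the double `D(Δ) = ∂(Δ × I)` being `S⁴`.

This file types Conjecture 13.3 in that DOUBLE FORM, with the Gluck ball presented as a Morse
puncturing of a Gluck twist (the tree's `IsGluckTwist`, `GluckTwist.lean`, and the regular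
superlevel pieces `RegularSuperlevel` of `RegularLevelSplitting.lean`, as in the puncturing
theorem `exists_isBoundaryGluing_superlevel_closedBall` of `SoloInformedFiveDimensionalRoute.lean`):

* `GluckBallDoubleConjecture` (`@[conjecture]`, OPEN): for every 2-knot `K`, every Gluck twist `X`
  of `S⁴` along `K`, every regular level `a` of a smooth `f : X → ℝ` whose sublevel `{f ≤ a}` is a
  4-disc, and every boundary datum `b` of `W := {a ≤ f}` with carrier `≅ S³`: every double
  `W ∪_{id} W̄` is diffeomorphic to `S⁴`.
* `gluckBallDoubleConjecture_of_poincareBallDoubleConjecture` (proved): Conjecture 13.1 (double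
  form, `PoincareBallDoubleConjecture`) implies it, given Gluck's theorem that `Σ_K ≃ S⁴`
  (tree named fact `nonempty_homotopyEquiv_sphere_of_isGluckTwist`, Gluck 1962 §17) — the
  punctured piece is then contractible by
  `RegularSublevel.contractibleSpace_superlevel_of_homotopyEquiv_sphere`
  (`HomotopySphereSuperlevelContractible.lean`).
* `GluckBallEmbeddingConjecture` (`@[conjecture]`, OPEN; Gabai Remark 13.14 p. 64, Kirby Problem
  4.23): Gluck balls smoothly embed in `S⁴`; `gluckBallEmbeddingConjecture_of_doubleConjecture`
  (proved): Conjecture 13.3 (double form) implies it (one half of the double), and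
  `gluckBallEmbeddingConjecture_of_poincareBallDoubleConjecture` chains it to Conjecture 13.1.

FAITHFULNESS.  (1) Printed 13.3 is about `Δ × I`; the double form is equivalent by Remarks 13.2 (i)
(a compact contractible 5-manifold with boundary `S⁴` is `B⁵`, Smale), not formalised.  (2) The
Gluck ball `Σ_K°` is well defined up to diffeomorphism by the Palais–Cerf disc theorem; here it is
ANY superlevel piece `{a ≤ f}` whose complementary sublevel is a disc, so the typed statement
quantifies over all Morse puncturings (each classically diffeomorphic to `Σ_K°`; the disc theorem is
not in the tree).  (3) `X` ranges over compact Hausdorff second-countable smooth 4-manifolds (charts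
on `ℝ⁴`) that are Gluck twists in the sense of `IsGluckTwist (𝓡 4) X K` (compactness is automatic
for a Gluck twist — Gluck 1962 §17, tree fact `IsGluckTwist.compactSpace` — and is assumed here so
that the superlevel piece is a compact manifold with boundary by instance).

STATUS / FRONTIER.  Open.  Implied by the Gluck conjecture (`Σ_K ≅ S⁴` for all `K`) and by
Conjecture 13.1.  Known: `K` a twist-spun or ribbon 2-knot (then `Σ_K ≅ S⁴`: Gordon 1976; Gluck
twists on ribbon knots are standard), and beyond standard `Σ`: Gabai–Naylor–Schwartz, *Doubles of
Gluck twists: a five dimensional approach*, Adv. Math. (2025), arXiv:2307.06388, Thm. 1.1 —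
`Σ_S° × I ≅ B⁵` for `S = D₁ ∪ D₂ ⊂ S⁴` a union of two ribbon discs one of which has undisking
number one (there `Σ_S` itself is not known to be standard).  The authors identify the first open
case as ribbon hemispheres of undisking number `≥ 2` (algebraic versus geometric cancellation of the
5-dimensional 2/3-handle pairs, their §1 and Lemma 3.5).

## References

* D. Gabai, arXiv:2212.02004v2 (2024), §13: p. 62 (Conj. 13.1, Remarks 13.2, Conj. 13.3), p. 64
  (Remark 13.14). [cite: Gabai2022, §13 Conj. 13.3]
* H. Gluck, *The embedding of two-spheres in the four-sphere*, Trans. AMS 104 (1962), §17.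
  [cite: GluckTAMS1962, §17]
* D. Gabai, P. Naylor, H. Schwartz, *Doubles of Gluck twists: a five dimensional approach*,
  arXiv:2307.06388, Adv. Math. 475 (2025), Thm. 1.1. [cite: arXiv:2307.06388, Thm. 1.1]
-/

noncomputable section

open scoped Manifold ContDiff Topology
open Set Function ContinuousMap

namespace Summit.SmoothPoincare4.SmoothPoincare4.Theorems

open Literature.Topology.FourManifolds

/-- OPEN CONJECTURE — **Gabai 2022, Conjecture 13.3 (Gluck balls), in the double form of
Remarks 13.2 (i).**  Printed: *"Conjecture 13.3. If `Δ⁴` is a Gluck ball, then `Δ⁴ × I = B⁵`."*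
Typed: for every 2-knot `K : 𝕊² ↪ 𝕊⁴`, every compact Hausdorff second-countable smooth
4-manifold `X` which is a Gluck twist of `S⁴` along `K` (`IsGluckTwist (𝓡 4) X K`), every regular value `a` of a
smooth `f : X → ℝ` whose sublevel manifold `{f ≤ a}` is diffeomorphic to the closed 4-disc (so that
`W := {a ≤ f}` is a Gluck ball `Σ_K°`), every boundary datum `b` of `W` whose carrier is
diffeomorphic to `S³`, and every smooth 4-manifold `P` which is the double of `W` along `b`
(`IsDouble`), `P` is diffeomorphic to `S⁴`.  Special case of `PoincareBallDoubleConjecture`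
(`gluckBallDoubleConjecture_of_poincareBallDoubleConjecture`) and of the Gluck conjecture.
Not dischargeable: use as a hypothesis. [cite: Gabai2022, §13 Conj. 13.3 and Remarks 13.2 (i)] -/
@[conjecture] def GluckBallDoubleConjecture : Prop :=
  ∀ (K : TwoKnot) (X : Type) [TopologicalSpace X] [T2Space X] [SecondCountableTopology X]
    [CompactSpace X] [ChartedSpace (EuclideanSpace ℝ (Fin 4)) X] [IsManifold (𝓡 4) ∞ X],
    IsGluckTwist (𝓡 4) X K →
    ∀ (f : X → ℝ) (a : ℝ) (h : IsRegularLevel (𝓡 (3 + 1)) f a),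
      Nonempty (RegularSublevel h ≃ₘ⟮𝓡∂ (3 + 1), 𝓡∂ (3 + 1)⟯
        (Metric.closedBall (0 : EuclideanSpace ℝ (Fin (3 + 1))) 1)) →
      ∀ (b : BoundaryData (𝓡∂ (3 + 1)) (RegularSuperlevel h) (𝓡 3)),
        Nonempty (b.carrier ≃ₘ⟮𝓡 3, 𝓡 3⟯ (Metric.sphere (0 : EuclideanSpace ℝ (Fin (3 + 1))) 1)) →
        ∀ (P : Type) [TopologicalSpace P] [T2Space P] [SecondCountableTopology P]
          [ChartedSpace (EuclideanSpace ℝ (Fin (3 + 1))) P] [IsManifold (𝓡 (3 + 1)) ∞ P],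
          IsDouble b (𝓡 (3 + 1)) P →
            Nonempty (P ≃ₘ⟮𝓡 (3 + 1), 𝓡 (3 + 1)⟯
              (Metric.sphere (0 : EuclideanSpace ℝ (Fin (3 + 1 + 1))) 1))

/-- OPEN QUESTION — **Gluck balls embed in `S⁴`** (Gabai 2022, Remark 13.14 p. 64: *"A positive
solution implies that Gluck balls embed in the 4-sphere. Compare with Problem 4.23 of [Ki1] and
Question 10.16 [Ga1]"*; the Gluck-ball case of the Poincaré ball embedding conjecture,
`PoincareBallEmbeddingConjecture`).  Typed with the same presentation of Gluck balls as
`GluckBallDoubleConjecture`: every Morse-punctured compact Gluck twist `{a ≤ f}` (with `{f ≤ a}` a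
4-disc and boundary `≅ S³`) admits a smooth embedding into the round `S⁴`.  Implied by
`GluckBallDoubleConjecture` (`gluckBallEmbeddingConjecture_of_doubleConjecture`).
Not dischargeable: use as a hypothesis. [cite: Gabai2022, §13 Remark 13.14] -/
@[conjecture] def GluckBallEmbeddingConjecture : Prop :=
  ∀ (K : TwoKnot) (X : Type) [TopologicalSpace X] [T2Space X] [SecondCountableTopology X]
    [CompactSpace X] [ChartedSpace (EuclideanSpace ℝ (Fin 4)) X] [IsManifold (𝓡 4) ∞ X],
    IsGluckTwist (𝓡 4) X K →
    ∀ (f : X → ℝ) (a : ℝ) (h : IsRegularLevel (𝓡 (3 + 1)) f a),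
      Nonempty (RegularSublevel h ≃ₘ⟮𝓡∂ (3 + 1), 𝓡∂ (3 + 1)⟯
        (Metric.closedBall (0 : EuclideanSpace ℝ (Fin (3 + 1))) 1)) →
      ∀ (b : BoundaryData (𝓡∂ (3 + 1)) (RegularSuperlevel h) (𝓡 3)),
        Nonempty (b.carrier ≃ₘ⟮𝓡 3, 𝓡 3⟯ (Metric.sphere (0 : EuclideanSpace ℝ (Fin (3 + 1))) 1)) →
        ∃ φ : RegularSuperlevel h → (Metric.sphere (0 : EuclideanSpace ℝ (Fin (3 + 1 + 1))) 1),
          Manifold.IsSmoothEmbedding (𝓡∂ (3 + 1)) (𝓡 (3 + 1)) ∞ φ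

/-- **Conjecture 13.1 ⇒ Conjecture 13.3 (double forms)**, given Gluck's theorem that a Gluck
twist is a homotopy 4-sphere (Gluck 1962, §17; tree named fact
`nonempty_homotopyEquiv_sphere_of_isGluckTwist`): the punctured piece `{a ≤ f}` of the Gluck
twist `X` is then contractible
(`RegularSublevel.contractibleSpace_superlevel_of_homotopyEquiv_sphere`, Kosinski VI §1), hence a
Poincaré ball, to which `PoincareBallDoubleConjecture` applies.
[cite: Gabai2022, §13 p. 62 ("a special case")] [cite: GluckTAMS1962, §17] -/
theorem gluckBallDoubleConjecture_of_poincareBallDoubleConjecture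
    (h17 : ∀ K : TwoKnot, nonempty_homotopyEquiv_sphere_of_isGluckTwist.{0} (K := K))
    (hD : PoincareBallDoubleConjecture) : GluckBallDoubleConjecture := by
  intro K X _ _ _ _ _ _ hX f a h hΨ b hb P _ _ _ _ _ hP
  obtain ⟨Ψ⟩ := hΨ
  obtain ⟨e⟩ := h17 K hX
  haveI : ContractibleSpace (RegularSuperlevel h) :=
    RegularSublevel.contractibleSpace_superlevel_of_homotopyEquiv_sphere (by norm_num) h Ψ e
  exact hD (RegularSuperlevel h) b hb P hP

/-- **Conjecture 13.3 (double form) ⇒ Gluck balls embed in `S⁴`**: one half of a double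
`W ∪_{id} W̄ ≅ S⁴` is a smoothly embedded copy of `W` (existence of the double:
`exists_isBoundaryGluing_holds`, `GluingProofs.lean`).  Cf. Gabai 2022, Remark 13.14 p. 64.
[cite: Gabai2022, §13 p. 62 and Remark 13.14] -/
theorem gluckBallEmbeddingConjecture_of_doubleConjecture (hG : GluckBallDoubleConjecture) :
    GluckBallEmbeddingConjecture := by
  intro K X _ _ _ _ _ _ hX f a h hΨ b hb
  obtain ⟨P, _, _, _, _, _, _, hP⟩ :=
    exists_isBoundaryGluing_holds b b (Diffeomorph.refl (𝓡 3) b.carrier ∞)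
  have hdouble : IsDouble b (𝓡 (3 + 1)) P := by
    refine IsClosedGluing.congr hP (fun x y => ?_)
    simp
  obtain ⟨ψ⟩ := hG K X hX f a h hΨ b hb P hdouble
  obtain ⟨jA, jB, hA, -, -, -⟩ := hdouble
  exact ⟨ψ ∘ jA, hA.diffeomorph_comp ψ⟩

/-- The chain from Conjecture 13.1: `PoincareBallDoubleConjecture` ⇒ Gluck balls embed in `S⁴`
(given Gluck 1962 §17). [cite: Gabai2022, §13 p. 62] -/
theorem gluckBallEmbeddingConjecture_of_poincareBallDoubleConjecture
    (h17 : ∀ K : TwoKnot, nonempty_homotopyEquiv_sphere_of_isGluckTwist.{0} (K := K))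
    (hD : PoincareBallDoubleConjecture) : GluckBallEmbeddingConjecture :=
  gluckBallEmbeddingConjecture_of_doubleConjecture
    (gluckBallDoubleConjecture_of_poincareBallDoubleConjecture h17 hD)

end Summit.SmoothPoincare4.SmoothPoincare4.Theorems

end
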